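import Summits.QuantumFields.YangMills.Theorems.VirialFluxGapTauberWeights
import Summits.QuantumFields.YangMills.Theorems.VirialFluxGapTauberMeanUpperPrep
import Summits.QuantumFields.YangMills.Theorems.VirialFluxGapLaplaceLayerCake
import HarnessLib

/-!
# Route `VirialFluxGap` (YangMills): a ONE-SIDED Tauberian mean bound from a MONOTONE SCALING LAW of the small-ball volume

Toward the deciding crux `VirialFluxGap.PeriodicSoftness` (item stmt-QuantumFields-24141; the route's LAST open leaf after
✓`SharpTwistedLaplace` / ✓`TwistedEquipartition`).  The existing Tauberian step of LINE «tauber-mean» / sub-route `ToronValleyVolume`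
(✓`TauberMeanUpper.tauberMeanUpper`) consumes a TWO-SIDED power-log small-ball law `m(t) = v t^ρ (e log t⁻¹ + c)(1 ± κt^θ)` (the open
heart ⟨stmt-QuantumFields-24497⟩ `ToronTubeVolumeLaw`).  This file proves that a much WEAKER, ONE-SIDED input suffices for the MEAN:

* `scalingTauber` — on a probability space, let `F ≥ 0` be measurable with volume function `m(t) = μ{F ≤ t}`.  Suppose the
  MONOTONE SCALING LAW `θ^α · m(t) ≤ m(θt)` for all `0 < θ ≤ 1`, `0 < t ≤ t₀` (equivalently: `t ↦ t^{−α} m(t)` is non-increasing on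
  `(0, t₀]` — «the sublevel volumes decay no faster than `t^α`»), a floor `m₁ ≤ m(t₀)`, `α ≥ 1`, `2 ≤ βt₀` and the threshold
  `(βt₀ + 1)(βt₀)^α e^{2 − βt₀} ≤ ε m₁`.  Then the Gibbs mean obeys `β⟨F⟩_β = β∫F e^{−βF}dμ / ∫e^{−βF}dμ ≤ α + ε`.

Proof.  By the Laplace layer cake (✓`LaplaceLayerCake`) the claim is `∫_{s>0} βe^{−βs}(βs − 1 − α − ε) m(s) ds ≤ 0`.  On `(0,t₀]` write
`m(s) = s^α n(s)` with `n(s) = s^{−α}m(s)` NON-INCREASING (the scaling law); against the Gamma weight `g(s) = βe^{−βs}s^α` the factor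
`βs − (1+α)` is increasing with VANISHING mean (✓`TauberWeights.integral_linear_mul_weight`: the mean of `Gamma(α+1,β)` is `(α+1)/β`),
so CHEBYSHEV's association inequality (✓`TauberWeights.chebyshev_weighted`, with the antitone factor `n·𝟙_{(0,t₀]}`) gives
`∫_{(0,t₀]} g (βs − 1 − α) n ≤ 0`; the `−ε` part contributes `−ε ∫_{(0,t₀]} βe^{−βs} m ≤ −ε m₁ t₀^{−α} e^{−2} β^{−α}`
(`n ≥ n(t₀) ≥ t₀^{−α} m₁` and ✓`TauberWeights.weight_floor`); beyond `t₀` the integrand is `≤ β²s e^{−βs}` with tail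
`(βt₀ + 1)e^{−βt₀}` (✓`TauberMeanUpperPrep.integral_Ioi_sq_mul_exp`).  NO two-sided law, NO slowly varying factor, NO constants
`v, e, c` are needed — only the one-sided monotonicity and a floor at ONE scale.

Use (next file `VirialFluxGapPeriodicSoftnessOfVolumeScaling`): with `F = F₀` the zero-flux ring deficit (✓`RingDeficit.deficitFormZero`),
`α = 9L⁴ − c` and `t₀ = 1/poly(L)`, a monotone scaling law for the toron valley at polynomial scale closes `PeriodicSoftness` on
Laplace windows `L ≤ β^a`; the scaling law is what the flow of an Euler-type vector field `V` (`V·∇F₀ ≥ 2(1−o(L⁻⁴))F₀`,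
`div V ≤ 18L⁴ − 2c`) produces.

HONEST FRAMING: generic real analysis (Mathlib + the landed Tauberian helpers); no stub / crux / rung / summit is closed by this file;
⟨24141⟩ stays OPEN; the Yang–Mills mass gap is NOT proved.  THEOREMS ONLY (0 `def`, 0 `sorry`), standard axioms.  Width seat
`ym-line-sfw-p2-w2` g51 (cell ym-idea-1, free hands), `--supports stmt-QuantumFields-24141`.
References: [cite: Griffiths1964]; [cite: TomboulisYaffe1985].
-/

set_option autoImplicit false

noncomputable section

open MeasureTheory Set Filter Real
open scoped Topology
open Summit.QuantumFields.YangMills.Theorems.VirialFluxGap.TauberWeights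
open Summit.QuantumFields.YangMills.Theorems.VirialFluxGap.TauberMeanUpperPrep
open Summit.QuantumFields.YangMills.Theorems.VirialFluxGap.LaplaceLayerCake

namespace Summit.QuantumFields.YangMills.Theorems.VirialFluxGap.ScalingTauber

/-! ## §1 The scaling law makes the normalised volume `s^{−α} m(s)·𝟙_{s ≤ t₀}` antitone on `(0,∞)` -/

/-- If `θ^α m(t) ≤ m(θt)` for `0 < θ ≤ 1`, `0 < t ≤ t₀` and `m ≥ 0`, then `s ↦ 𝟙_{s ≤ t₀}· s^{−α} m(s)` is antitone on `(0,∞)`.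
[folklore] -/
theorem antitoneOn_indicator_rpow_neg_mul {m : ℝ → ℝ} {α t₀ : ℝ} (hm0 : ∀ s, 0 ≤ m s)
    (hscal : ∀ t : ℝ, 0 < t → t ≤ t₀ → ∀ θ : ℝ, 0 < θ → θ ≤ 1 → θ ^ α * m t ≤ m (θ * t)) :
    AntitoneOn ((Iic t₀).indicator fun s => s ^ (-α) * m s) (Ioi 0) := by
  intro x hx y hy hxy
  have hx0 : (0 : ℝ) < x := hx
  have hy0 : (0 : ℝ) < y := hy
  by_cases hyt : y ≤ t₀
  · have hxt : x ≤ t₀ := hxy.trans hyt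
    rw [indicator_of_mem (mem_Iic.mpr hxt), indicator_of_mem (mem_Iic.mpr hyt)]
    have hθ0 : 0 < x / y := div_pos hx0 hy0
    have hθ1 : x / y ≤ 1 := (div_le_one hy0).mpr hxy
    have h := hscal y hy0 hyt (x / y) hθ0 hθ1
    rw [div_mul_cancel₀ x hy0.ne'] at h
    have hxα : 0 < x ^ α := Real.rpow_pos_of_pos hx0 α
    have e1 : (x / y) ^ α = x ^ α * y ^ (-α) := by
      rw [Real.div_rpow hx0.le hy0.le, Real.rpow_neg hy0.le, div_eq_mul_inv]
    have hxnα : x ^ (-α) = (x ^ α)⁻¹ := Real.rpow_neg hx0.le α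
    calc y ^ (-α) * m y = (x ^ α)⁻¹ * ((x / y) ^ α * m y) := by
          rw [e1]; field_simp
      _ ≤ (x ^ α)⁻¹ * m x := mul_le_mul_of_nonneg_left h (inv_nonneg.mpr hxα.le)
      _ = x ^ (-α) * m x := by rw [hxnα]
  · rw [indicator_of_notMem (fun h => hyt (mem_Iic.mp h))]
    by_cases hxt : x ≤ t₀
    · rw [indicator_of_mem (mem_Iic.mpr hxt)]
      exact mul_nonneg (Real.rpow_nonneg hx0.le _) (hm0 x)
    · rw [indicator_of_notMem (fun h => hxt (mem_Iic.mp h))]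

/-- The scaling law propagates a floor downward: `m(s) ≥ (s/t₀)^α m(t₀)`, i.e. `t₀^{−α} m(t₀) ≤ s^{−α} m(s)` for `0 < s ≤ t₀`. [folklore] -/
theorem rpow_neg_mul_le_of_scaling {m : ℝ → ℝ} {α t₀ s : ℝ} (ht₀ : 0 < t₀) (hs : 0 < s) (hst : s ≤ t₀)
    (hscal : ∀ t : ℝ, 0 < t → t ≤ t₀ → ∀ θ : ℝ, 0 < θ → θ ≤ 1 → θ ^ α * m t ≤ m (θ * t)) :
    t₀ ^ (-α) * m t₀ ≤ s ^ (-α) * m s := by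
  have hθ0 : 0 < s / t₀ := div_pos hs ht₀
  have hθ1 : s / t₀ ≤ 1 := (div_le_one ht₀).mpr hst
  have h := hscal t₀ ht₀ le_rfl (s / t₀) hθ0 hθ1
  rw [div_mul_cancel₀ s ht₀.ne'] at h
  have hsα : 0 < s ^ α := Real.rpow_pos_of_pos hs α
  have e1 : (s / t₀) ^ α = s ^ α * t₀ ^ (-α) := by
    rw [Real.div_rpow hs.le ht₀.le, Real.rpow_neg ht₀.le, div_eq_mul_inv]
  have hsnα : s ^ (-α) = (s ^ α)⁻¹ := Real.rpow_neg hs.le α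
  calc t₀ ^ (-α) * m t₀ = (s ^ α)⁻¹ * ((s / t₀) ^ α * m t₀) := by
        rw [e1]; field_simp
    _ ≤ (s ^ α)⁻¹ * m s := mul_le_mul_of_nonneg_left h (inv_nonneg.mpr hsα.le)
    _ = s ^ (-α) * m s := by rw [hsnα]

/-! ## §2 The one-sided Tauberian mean bound -/

/-- ★★★ **Scaling Tauberian bound** (one-sided).  On a probability space let `F ≥ 0` be measurable with volume function
`m(t) = μ{F ≤ t}`; assume the MONOTONE SCALING LAW `θ^α m(t) ≤ m(θt)` (`0 < θ ≤ 1`, `0 < t ≤ t₀`), a floor `m₁ ≤ m(t₀)`, `α ≥ 1`,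
`2 ≤ βt₀`, and the threshold `(βt₀ + 1)(βt₀)^α e^{2 − βt₀} ≤ ε m₁`.  Then `β·∫F e^{−βF}dμ / ∫e^{−βF}dμ ≤ α + ε`.
No crux / rung / summit is proved; the YM mass gap is NOT proved. [cite: Griffiths1964] [cite: TomboulisYaffe1985] -/
theorem scalingTauber {Ω : Type*} [MeasurableSpace Ω] (μ : Measure Ω) [IsProbabilityMeasure μ] {F : Ω → ℝ}
    (hF : Measurable F) (hF0 : ∀ ω, 0 ≤ F ω) {α t₀ m₁ ε β : ℝ}
    (hα : 1 ≤ α) (ht₀ : 0 < t₀) (hm₁ : 0 < m₁) (hε : 0 < ε) (hβ : 0 < β) (hβt : 2 ≤ β * t₀)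
    (hfloor : m₁ ≤ μ.real {ω | F ω ≤ t₀})
    (hscal : ∀ t : ℝ, 0 < t → t ≤ t₀ → ∀ θ : ℝ, 0 < θ → θ ≤ 1 → θ ^ α * μ.real {ω | F ω ≤ t} ≤ μ.real {ω | F ω ≤ θ * t})
    (hthr : (β * t₀ + 1) * (β * t₀) ^ α * Real.exp (2 - β * t₀) ≤ ε * m₁) :
    β * (∫ ω, F ω * Real.exp (-(β * F ω)) ∂μ) / (∫ ω, Real.exp (-(β * F ω)) ∂μ) ≤ α + ε := by
  -- constants
  have hα0 : 0 < α := by linarith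
  have hαm1 : -1 < α := by linarith
  set A : ℝ := 1 + α + ε with hA
  have hA0 : 0 ≤ A := by positivity
  have hA1 : 0 ≤ 1 + α := by positivity
  have h2β : 2 / β ≤ t₀ := by rw [div_le_iff₀ hβ]; linarith
  -- the functions
  set m : ℝ → ℝ := fun s => μ.real {ω | F ω ≤ s} with hm
  set h : ℝ → ℝ := (Iic t₀).indicator fun s => s ^ (-α) * m s with hh
  set g : ℝ → ℝ := fun s => β * Real.exp (-(β * s)) * s ^ α with hg
  -- `m`: monotone, measurable, `0 ≤ m ≤ 1`
  have hm_mono : Monotone m := by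
    intro s s' hss'
    exact measureReal_mono (fun ω (hω : F ω ≤ s) => hω.trans hss')
  have hm_meas : Measurable m := hm_mono.measurable
  have hm0 : ∀ s, 0 ≤ m s := fun s => measureReal_nonneg
  have hm1 : ∀ s, m s ≤ 1 := fun s =>
    (measureReal_mono (subset_univ _)).trans (le_of_eq probReal_univ)
  -- `h`: antitone on `(0,∞)`, non-negative, measurable, floor
  have hh_anti : AntitoneOn h (Ioi 0) := antitoneOn_indicator_rpow_neg_mul hm0 hscal
  have hh_nonneg : ∀ s, 0 < s → 0 ≤ h s := by
    intro s hs
    by_cases hst : s ≤ t₀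
    · rw [hh, indicator_of_mem (mem_Iic.mpr hst)]
      exact mul_nonneg (Real.rpow_nonneg hs.le _) (hm0 s)
    · rw [hh, indicator_of_notMem (fun h => hst (mem_Iic.mp h))]
  have hhm : Measurable h := ((measurable_id.pow_const (-α)).mul hm_meas).indicator measurableSet_Iic
  have hh_floor : ∀ s, 0 < s → s ≤ t₀ → t₀ ^ (-α) * m₁ ≤ h s := by
    intro s hs hst
    rw [hh, indicator_of_mem (mem_Iic.mpr hst)]
    calc t₀ ^ (-α) * m₁ ≤ t₀ ^ (-α) * m t₀ := mul_le_mul_of_nonneg_left hfloor (Real.rpow_nonneg ht₀.le _)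
      _ ≤ s ^ (-α) * m s := rpow_neg_mul_le_of_scaling ht₀ hs hst hscal
  -- `g`: the Gamma weight
  have hgm : Measurable g :=
    (measurable_const.mul (measurable_const.mul measurable_id).neg.exp).mul (measurable_id.pow_const α)
  have hgi : IntegrableOn g (Ioi 0) := integrableOn_weight hβ hαm1
  have hg_nonneg : ∀ s ∈ Ioi (0:ℝ), 0 ≤ g s := fun s hs => by
    rw [hg]; have := Real.rpow_nonneg (le_of_lt (hs : (0:ℝ) < s)) α; positivity
  have hG0 : 0 < ∫ s in Ioi (0:ℝ), g s := by rw [hg]; exact integral_weight_pos hβ hαm1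
  -- `g · h = βe^{−βs} m · 𝟙_{≤ t₀}` on `(0,∞)`
  have hgh : ∀ s, 0 < s → g s * h s = (Iic t₀).indicator (fun s => β * Real.exp (-(β * s)) * m s) s := by
    intro s hs
    by_cases hst : s ≤ t₀
    · rw [hh, indicator_of_mem (mem_Iic.mpr hst), indicator_of_mem (mem_Iic.mpr hst), hg]
      have hαα : s ^ α * s ^ (-α) = 1 := by
        rw [Real.rpow_neg hs.le, mul_inv_cancel₀ (Real.rpow_pos_of_pos hs α).ne']
      calc β * Real.exp (-(β * s)) * s ^ α * (s ^ (-α) * m s)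
          = β * Real.exp (-(β * s)) * (s ^ α * s ^ (-α)) * m s := by ring
        _ = β * Real.exp (-(β * s)) * m s := by rw [hαα, mul_one]
    · rw [hh, indicator_of_notMem (fun h => hst (mem_Iic.mp h)), indicator_of_notMem (fun h => hst (mem_Iic.mp h)), mul_zero]
  -- the two exponential weights without `s^α`
  have i_w0 : IntegrableOn (fun s : ℝ => β * Real.exp (-(β * s))) (Ioi 0) :=
    (integrableOn_weight hβ (a := 0) (by norm_num)).congr_fun (fun s _ => by simp only [Real.rpow_zero, mul_one]) measurableSet_Ioi
  have i_w1 : IntegrableOn (fun s : ℝ => β * Real.exp (-(β * s)) * s) (Ioi 0) :=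
    (integrableOn_weight hβ (a := 1) (by norm_num)).congr_fun (fun s _ => by simp only [Real.rpow_one]) measurableSet_Ioi
  -- `D > 0` and the reduction to `βN ≤ (α+ε)D`
  have hDi : Integrable (fun ω => Real.exp (-(β * F ω))) μ := by
    refine Integrable.of_bound (hF.const_mul β).neg.exp.aestronglyMeasurable 1 (ae_of_all _ fun ω => ?_)
    rw [Real.norm_eq_abs, Real.abs_exp]
    exact Real.exp_le_one_iff.mpr (by have := hF0 ω; nlinarith)
  have hD : 0 < ∫ ω, Real.exp (-(β * F ω)) ∂μ := integral_exp_pos hDi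
  rw [div_le_iff₀ hD]
  -- layer cake
  rw [integral_mul_exp_neg_mul_eq_integral_cdf μ hF hF0 hβ, integral_exp_neg_mul_eq_integral_cdf μ hF hF0 hβ]
  -- integrability of the two layer-cake integrands
  have i_Dm : IntegrableOn (fun s : ℝ => β * Real.exp (-(β * s)) * m s) (Ioi 0) := by
    refine Integrable.mono' i_w0 ((measurable_const.mul (measurable_const.mul measurable_id).neg.exp).mul hm_meas).aestronglyMeasurable
      (ae_of_all _ fun s => ?_)
    rw [Real.norm_eq_abs, abs_mul, abs_of_nonneg (by positivity : (0:ℝ) ≤ β * Real.exp (-(β * s))), abs_of_nonneg (hm0 s)]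
    exact mul_le_of_le_one_right (by positivity) (hm1 s)
  have i_Nm : IntegrableOn (fun s : ℝ => (β * s - 1) * Real.exp (-(β * s)) * m s) (Ioi 0) := by
    have hb : IntegrableOn (fun s : ℝ => β * Real.exp (-(β * s)) * s + β⁻¹ * (β * Real.exp (-(β * s)))) (Ioi 0) :=
      i_w1.add (i_w0.const_mul _)
    refine Integrable.mono' hb ((((measurable_const.mul measurable_id).sub_const 1).mul
      (measurable_const.mul measurable_id).neg.exp).mul hm_meas).aestronglyMeasurable ?_
    filter_upwards [ae_restrict_mem measurableSet_Ioi] with s hs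
    have hs' : (0:ℝ) < s := hs
    rw [Real.norm_eq_abs, abs_mul, abs_of_nonneg (hm0 s)]
    have hexp : 0 < Real.exp (-(β * s)) := Real.exp_pos _
    have h1 : |β * s - 1| ≤ β * s + 1 := by
      calc |β * s - 1| ≤ |β * s| + |1| := abs_sub _ _
        _ = β * s + 1 := by rw [abs_of_nonneg (by positivity), abs_one]
    calc |(β * s - 1) * Real.exp (-(β * s))| * m s ≤ |(β * s - 1) * Real.exp (-(β * s))| * 1 :=
          mul_le_mul_of_nonneg_left (hm1 s) (abs_nonneg _)
      _ = |β * s - 1| * Real.exp (-(β * s)) := by rw [mul_one, abs_mul, abs_of_pos hexp]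
      _ ≤ (β * s + 1) * Real.exp (-(β * s)) := mul_le_mul_of_nonneg_right h1 hexp.le
      _ = β * Real.exp (-(β * s)) * s + β⁻¹ * (β * Real.exp (-(β * s))) := by field_simp
  -- `βN − (α+ε)D = ∫ φ m`
  have hφ : β * (∫ s in Ioi (0:ℝ), (β * s - 1) * Real.exp (-(β * s)) * m s) -
      (α + ε) * (∫ s in Ioi (0:ℝ), β * Real.exp (-(β * s)) * m s) =
      ∫ s in Ioi (0:ℝ), β * Real.exp (-(β * s)) * (β * s - A) * m s := by
    rw [← integral_const_mul, ← integral_const_mul, ← integral_sub (i_Nm.const_mul β) (i_Dm.const_mul _)]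
    refine setIntegral_congr_fun measurableSet_Ioi (fun s _ => ?_)
    rw [hA]; ring
  suffices key : ∫ s in Ioi (0:ℝ), β * Real.exp (-(β * s)) * (β * s - A) * m s ≤ 0 by linarith
  -- ### the key estimate
  -- integrability of `g h`, `g (βs − (1+α)) h`, `g (βs − (1+α))`
  have i_gh : IntegrableOn (fun s => g s * h s) (Ioi 0) := by
    have hb : IntegrableOn (fun s : ℝ => (Iic t₀).indicator (fun s => β * Real.exp (-(β * s)) * m s) s) (Ioi 0) :=
      i_Dm.indicator measurableSet_Iic
    exact hb.congr_fun (fun s hs => (hgh s hs).symm) measurableSet_Ioi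
  have i_ind : IntegrableOn (fun s : ℝ => (Iic t₀).indicator (fun s => β * Real.exp (-(β * s)) * (β * s - (1 + α)) * m s) s) (Ioi 0) := by
    have hb : IntegrableOn (fun s : ℝ => β * Real.exp (-(β * s)) * (β * s - (1 + α)) * m s) (Ioi 0) := by
      have h1 : IntegrableOn (fun s : ℝ => β * (β * Real.exp (-(β * s)) * s) + (1 + α) * (β * Real.exp (-(β * s)))) (Ioi 0) :=
        (i_w1.const_mul β).add (i_w0.const_mul _)
      refine Integrable.mono' h1 ((((measurable_const.mul (measurable_const.mul measurable_id).neg.exp).mul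
        ((measurable_const.mul measurable_id).sub_const (1 + α))).mul hm_meas).aestronglyMeasurable) ?_
      filter_upwards [ae_restrict_mem measurableSet_Ioi] with s hs
      have hs' : (0:ℝ) < s := hs
      have hw : 0 ≤ β * Real.exp (-(β * s)) := by positivity
      rw [Real.norm_eq_abs, abs_mul, abs_mul, abs_of_nonneg hw, abs_of_nonneg (hm0 s)]
      have h1 : |β * s - (1 + α)| ≤ β * s + (1 + α) := by
        calc |β * s - (1 + α)| ≤ |β * s| + |1 + α| := abs_sub _ _
          _ = β * s + (1 + α) := by rw [abs_of_nonneg (by positivity), abs_of_nonneg hA1]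
      calc β * Real.exp (-(β * s)) * |β * s - (1 + α)| * m s ≤ β * Real.exp (-(β * s)) * |β * s - (1 + α)| * 1 :=
            mul_le_mul_of_nonneg_left (hm1 s) (mul_nonneg hw (abs_nonneg _))
        _ ≤ β * Real.exp (-(β * s)) * (β * s + (1 + α)) := by rw [mul_one]; exact mul_le_mul_of_nonneg_left h1 hw
        _ = β * (β * Real.exp (-(β * s)) * s) + (1 + α) * (β * Real.exp (-(β * s))) := by ring
    exact hb.indicator measurableSet_Iic
  have hgfh : ∀ s, 0 < s → g s * ((β * s - (1 + α)) * h s) =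
      (Iic t₀).indicator (fun s => β * Real.exp (-(β * s)) * (β * s - (1 + α)) * m s) s := by
    intro s hs
    have e : g s * ((β * s - (1 + α)) * h s) = (β * s - (1 + α)) * (g s * h s) := by ring
    rw [e, hgh s hs]
    by_cases hst : s ≤ t₀
    · rw [indicator_of_mem (mem_Iic.mpr hst), indicator_of_mem (mem_Iic.mpr hst)]; ring
    · rw [indicator_of_notMem (fun h => hst (mem_Iic.mp h)), indicator_of_notMem (fun h => hst (mem_Iic.mp h)), mul_zero]
  have i_gfh : IntegrableOn (fun s => g s * ((β * s - (1 + α)) * h s)) (Ioi 0) :=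
    i_ind.congr_fun (fun s hs => (hgfh s hs).symm) measurableSet_Ioi
  have i_gf : IntegrableOn (fun s => g s * (β * s - (1 + α))) (Ioi 0) := by
    refine integrableOn_of_le_K (C := β + (1 + α)) hβ hα0 (hgm.mul ((measurable_const.mul measurable_id).sub_const (1 + α)))
      fun s hs => ?_
    exact dom_core' hβ hs (linear_abs_le hβ hA1 hs (le_refl (0:ℝ)) zero_le_one).1
  -- the majorant
  set M : ℝ → ℝ := fun s => g s * ((β * s - (1 + α)) * h s) - ε * (g s * h s) +
    (Ioi t₀).indicator (fun s => β * (β * s) * Real.exp (-(β * s))) s with hM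
  have i_tail : IntegrableOn (fun s : ℝ => β * (β * s) * Real.exp (-(β * s))) (Ioi 0) := by
    have h : IntegrableOn (fun s : ℝ => β * (β * Real.exp (-(β * s)) * s)) (Ioi 0) := i_w1.const_mul β
    exact h.congr_fun (fun s _ => by ring) measurableSet_Ioi
  have i_M : IntegrableOn M (Ioi 0) :=
    (i_gfh.sub (i_gh.const_mul ε)).add (i_tail.indicator measurableSet_Ioi)
  have i_φm : IntegrableOn (fun s : ℝ => β * Real.exp (-(β * s)) * (β * s - A) * m s) (Ioi 0) := by
    have h : IntegrableOn (fun s : ℝ => β * ((β * s - 1) * Real.exp (-(β * s)) * m s) -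
        (α + ε) * (β * Real.exp (-(β * s)) * m s)) (Ioi 0) := (i_Nm.const_mul β).sub (i_Dm.const_mul (α + ε))
    exact h.congr_fun (fun s _ => by rw [hA]; ring) measurableSet_Ioi
  -- pointwise comparison
  have hpt : ∀ s ∈ Ioi (0:ℝ), β * Real.exp (-(β * s)) * (β * s - A) * m s ≤ M s := by
    intro s hs
    have hs' : (0:ℝ) < s := hs
    have hw : 0 ≤ β * Real.exp (-(β * s)) := by positivity
    by_cases hst : s ≤ t₀
    · -- inside `(0, t₀]`: equality of the first two terms
      have hind : (Ioi t₀).indicator (fun s => β * (β * s) * Real.exp (-(β * s))) s = 0 :=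
        indicator_of_notMem (fun h => not_lt.mpr hst (mem_Ioi.mp h)) _
      rw [hM]; dsimp only
      rw [hind, add_zero, hgfh s hs', hgh s hs', indicator_of_mem (mem_Iic.mpr hst), indicator_of_mem (mem_Iic.mpr hst), hA]
      have e : β * Real.exp (-(β * s)) * (β * s - (1 + α + ε)) * m s =
          β * Real.exp (-(β * s)) * (β * s - (1 + α)) * m s - ε * (β * Real.exp (-(β * s)) * m s) := by ring
      rw [e]
    · -- beyond `t₀`: `φ m ≤ β² s e^{−βs}`
      have hst' : t₀ < s := lt_of_not_ge hst
      have hind : (Ioi t₀).indicator (fun s => β * (β * s) * Real.exp (-(β * s))) s = β * (β * s) * Real.exp (-(β * s)) :=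
        indicator_of_mem (mem_Ioi.mpr hst') _
      have hhs : h s = 0 := by rw [hh, indicator_of_notMem (fun h => hst (mem_Iic.mp h))]
      rw [hM]; dsimp only; rw [hind, hhs]
      simp only [mul_zero, sub_zero, zero_add]
      have h1 : β * Real.exp (-(β * s)) * (β * s - A) * m s ≤ β * Real.exp (-(β * s)) * (β * s) * m s := by
        have h0 : 0 ≤ β * Real.exp (-(β * s)) * A * m s := mul_nonneg (mul_nonneg hw hA0) (hm0 s)
        have e : β * Real.exp (-(β * s)) * (β * s - A) * m s =
            β * Real.exp (-(β * s)) * (β * s) * m s - β * Real.exp (-(β * s)) * A * m s := by ring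
        linarith
      have h2 : β * Real.exp (-(β * s)) * (β * s) * m s ≤ β * Real.exp (-(β * s)) * (β * s) :=
        mul_le_of_le_one_right (by positivity) (hm1 s)
      calc β * Real.exp (-(β * s)) * (β * s - A) * m s ≤ β * Real.exp (-(β * s)) * (β * s) := h1.trans h2
        _ = β * (β * s) * Real.exp (-(β * s)) := by ring
  have hint_le : ∫ s in Ioi (0:ℝ), β * Real.exp (-(β * s)) * (β * s - A) * m s ≤ ∫ s in Ioi (0:ℝ), M s :=
    setIntegral_mono_on i_φm i_M measurableSet_Ioi hpt
  -- ### evaluate / bound `∫ M`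
  set Hh : ℝ := ∫ s in Ioi (0:ℝ), g s * h s with hHh
  have hM_int : ∫ s in Ioi (0:ℝ), M s = (∫ s in Ioi (0:ℝ), g s * ((β * s - (1 + α)) * h s)) - ε * Hh +
      (β * t₀ + 1) * Real.exp (-(β * t₀)) := by
    have i12 : IntegrableOn (fun s => g s * ((β * s - (1 + α)) * h s) - ε * (g s * h s)) (Ioi 0) := i_gfh.sub (i_gh.const_mul ε)
    have iind : IntegrableOn (fun s : ℝ => (Ioi t₀).indicator (fun s => β * (β * s) * Real.exp (-(β * s))) s) (Ioi 0) :=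
      i_tail.indicator measurableSet_Ioi
    rw [hM]; dsimp only
    rw [integral_add i12 iind, integral_sub i_gfh (i_gh.const_mul ε), integral_const_mul,
      setIntegral_indicator measurableSet_Ioi, Ioi_inter_Ioi, show (0:ℝ) ⊔ t₀ = t₀ from max_eq_right ht₀.le,
      integral_Ioi_sq_mul_exp hβ ht₀.le]
  -- Chebyshev: `∫ g (βs−(1+α)) h ≤ 0` since the first moment vanishes
  have hHh0 : 0 ≤ Hh := by
    rw [hHh]; exact setIntegral_nonneg measurableSet_Ioi fun s hs => mul_nonneg (hg_nonneg s hs) (hh_nonneg s hs)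
  have hfmono : MonotoneOn (fun s : ℝ => β * s - (1 + α)) (Ioi 0) := fun x _ y _ hxy => by
    have := mul_le_mul_of_nonneg_left hxy hβ.le
    simp only; linarith
  have cheb := chebyshev_weighted measurableSet_Ioi hg_nonneg hgm hgi hfmono hh_anti i_gf i_gh i_gfh
  have hmom1 : ∫ s in Ioi (0:ℝ), g s * (β * s - (1 + α)) = 0 := by
    have h := integral_linear_mul_weight hβ hαm1 (1 + α)
    rw [hg]
    rw [show (∫ s in Ioi (0:ℝ), β * Real.exp (-(β * s)) * s ^ α * (β * s - (1 + α))) =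
        ∫ s in Ioi (0:ℝ), (β * s - (1 + α)) * (β * Real.exp (-(β * s)) * s ^ α) from
        setIntegral_congr_fun measurableSet_Ioi (fun s _ => by ring), h]
    ring
  have hX1 : ∫ s in Ioi (0:ℝ), g s * ((β * s - (1 + α)) * h s) ≤ 0 := by
    rw [hmom1, zero_mul] at cheb
    refine le_of_not_gt fun hcon => ?_
    have : 0 < (∫ s in Ioi (0:ℝ), g s * ((β * s - (1 + α)) * h s)) * (∫ s in Ioi (0:ℝ), g s) := mul_pos hcon hG0
    linarith
  -- the floor `Hh ≥ m₁ t₀^{−α} e^{−2} β^{−α}`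
  have hfloorH : t₀ ^ (-α) * m₁ * (Real.exp (-2) * β ^ (-α)) ≤ Hh := by
    have hsub : Ioc (0:ℝ) t₀ ⊆ Ioi 0 := Ioc_subset_Ioi_self
    have hgi' : IntegrableOn g (Ioc 0 t₀) := hgi.mono_set hsub
    have h1 : t₀ ^ (-α) * m₁ * (Real.exp (-2) * β ^ (-α)) ≤ ∫ s in Ioc (0:ℝ) t₀, g s * (t₀ ^ (-α) * m₁) := by
      rw [integral_mul_const, mul_comm]
      exact mul_le_mul_of_nonneg_right (by rw [hg]; exact weight_floor hβ hα0.le h2β)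
        (mul_nonneg (Real.rpow_nonneg ht₀.le _) hm₁.le)
    have h2 : ∫ s in Ioc (0:ℝ) t₀, g s * (t₀ ^ (-α) * m₁) ≤ ∫ s in Ioc (0:ℝ) t₀, g s * h s := by
      refine setIntegral_mono_on (hgi'.mul_const _) (i_gh.mono_set hsub) measurableSet_Ioc fun s hs => ?_
      exact mul_le_mul_of_nonneg_left (hh_floor s hs.1 hs.2) (hg_nonneg s (hsub hs))
    have h3 : ∫ s in Ioc (0:ℝ) t₀, g s * h s ≤ Hh := by
      rw [hHh]
      refine setIntegral_mono_set i_gh ?_ (Eventually.of_forall hsub)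
      filter_upwards [ae_restrict_mem measurableSet_Ioi] with s hs using mul_nonneg (hg_nonneg s hs) (hh_nonneg s hs)
    exact h1.trans (h2.trans h3)
  -- the tail against the floor: `(βt₀+1)e^{−βt₀} ≤ ε · m₁ t₀^{−α} e^{−2} β^{−α}`
  have htail : (β * t₀ + 1) * Real.exp (-(β * t₀)) ≤ ε * (t₀ ^ (-α) * m₁ * (Real.exp (-2) * β ^ (-α))) := by
    have hX0 : 0 < β * t₀ := mul_pos hβ ht₀
    have hXα : 0 < (β * t₀) ^ α := Real.rpow_pos_of_pos hX0 α
    have hneg : (β * t₀) ^ (-α) = ((β * t₀) ^ α)⁻¹ := Real.rpow_neg hX0.le α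
    have hsplit : t₀ ^ (-α) * β ^ (-α) = (β * t₀) ^ (-α) := by
      rw [Real.mul_rpow hβ.le ht₀.le]; ring
    have hexp : Real.exp (2 - β * t₀) = Real.exp (-(β * t₀)) * (Real.exp (-2))⁻¹ := by
      rw [← Real.exp_neg, neg_neg, ← Real.exp_add]; ring_nf
    -- from `hthr`: `(βt₀+1) e^{−βt₀} e^{2} (βt₀)^α ≤ ε m₁`
    have key : (β * t₀ + 1) * Real.exp (-(β * t₀)) * ((β * t₀) ^ α * (Real.exp (-2))⁻¹) ≤ ε * m₁ := by
      calc (β * t₀ + 1) * Real.exp (-(β * t₀)) * ((β * t₀) ^ α * (Real.exp (-2))⁻¹)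
          = (β * t₀ + 1) * (β * t₀) ^ α * Real.exp (2 - β * t₀) := by rw [hexp]; ring
        _ ≤ ε * m₁ := hthr
    have hc0 : 0 < (β * t₀) ^ α * (Real.exp (-2))⁻¹ := mul_pos hXα (inv_pos.mpr (Real.exp_pos _))
    rw [← le_div_iff₀ hc0] at key
    refine key.trans (le_of_eq ?_)
    rw [show t₀ ^ (-α) * m₁ * (Real.exp (-2) * β ^ (-α)) = m₁ * Real.exp (-2) * (t₀ ^ (-α) * β ^ (-α)) by ring, hsplit, hneg]
    field_simp
  -- conclude
  calc ∫ s in Ioi (0:ℝ), β * Real.exp (-(β * s)) * (β * s - A) * m s ≤ ∫ s in Ioi (0:ℝ), M s := hint_le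
    _ = (∫ s in Ioi (0:ℝ), g s * ((β * s - (1 + α)) * h s)) - ε * Hh + (β * t₀ + 1) * Real.exp (-(β * t₀)) := hM_int
    _ ≤ 0 - ε * (t₀ ^ (-α) * m₁ * (Real.exp (-2) * β ^ (-α))) + ε * (t₀ ^ (-α) * m₁ * (Real.exp (-2) * β ^ (-α))) := by
        have h1 := mul_le_mul_of_nonneg_left hfloorH hε.le
        linarith
    _ = 0 := by ring

end Summit.QuantumFields.YangMills.Theorems.VirialFluxGap.ScalingTauber

end
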